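import Literature.NumberTheory.QuadraticFields.SqrtNegTwoPrimary
import Literature.NumberTheory.QuadraticFields.OmegaRingOfIntegers
import Mathlib.RingTheory.Norm.Transitivity
import HarnessLib

/-!
# The ring of integers of `ℚ(√−2)` is `ℤ[√−2]` — as a ring isomorphism with Mathlib's `ℤ√(-2)`

Topic `Literature/NumberTheory/QuadraticFields`, namespace `Literature.NumberTheory.QuadraticFields.SqrtNegTwoIntegers`.
Marcus, *Number Fields*, Ch. 2 Thm. 1 with Cor. 2, the case `m ≡ 2, 3 (mod 4)`: «the set of algebraic integers in `ℚ[√m]` is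
`{a + b√m : a, b ∈ ℤ}`», here for `m = −2`, for a GIVEN quadratic number field `K` (`[K : ℚ] = 2`) presented by a square root
`θ ∈ K`, `θ² = −2`.  The `d ≡ 1 (mod 4)` twin is `OmegaRingOfIntegers` (`ℤ[½(1+√d)]`, by traces alone); here the NORM is needed as
well (`½√−2` has integral traces): for `z = r + sθ` integral, `Tr z = 2r ∈ ℤ` and `N z = r² + 2s² ∈ ℤ`, so `(4s)² = 2(4N − Tr²) ∈ ℤ`,
`4s ∈ ℤ`, and a parity descent gives `r, s ∈ ℤ`.  The tree's arithmetic of `ℤ[√−2]` (`SqrtNegTwoPrimary`: Rajwade's primary elements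
and the Hecke sums of the `j = 8000` curves; the Euclidean structure of `MordellEquationMinusTwo`) thereby meets `𝓞 K`.  THEOREMS and
three definitions (`toField`, `toIntegers`, `equivIntegers`); no instance, no named fact.

* §1 `toField θ hsq : ℤ√(-2) →+* K`, `a + b√−2 ↦ a + bθ` (Mathlib's `Zsqrtd.lift`), injective, with integral values; `θ ∉ ℚ`; the
  non-trivial automorphism `c` of `K` has `c θ = −θ`, and `N_{K/ℚ}(r + sθ) = r² + 2s²` (`norm_ratCast_add_ratCast_mul`);
* §2 ★ `exists_toField_eq_of_isIntegral` — every algebraic integer of `K` is `a + bθ` with `a, b ∈ ℤ`;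
* §3 ★★ `equivIntegers h2 hsq : ℤ√(-2) ≃+* 𝓞 K` (`coe_equivIntegers`), and `isPrincipalIdealRing_ringOfIntegers` (transported from
  the Euclidean domain `ℤ√(-2)`; also the tree's `Quadratic.isPrincipalIdealRing_of_sq_eq_intCast` at `d = −8`).

## References
* D. A. Marcus, *Number Fields*, 2nd ed. (2018), Ch. 2, Thm. 1 and Cor. 2. [Marcus2018]
* K. Ireland, M. Rosen, *A Classical Introduction to Modern Number Theory*, 2nd ed. (1990), Ch. 13 §1 Prop. 13.1.1. [IrelandRosen1990]

## Mathlib / tree search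
Mathlib: `Zsqrtd.lift`, `Zsqrtd.lift_injective`, `Algebra.isIntegral_trace`, `Algebra.isIntegral_norm`, `IsIntegrallyClosed.isIntegral_iff`,
`IsIntegral.of_pow`, `Algebra.norm_eq_prod_automorphisms`, `IsGalois.card_aut_eq_finrank`, `IsPrincipalIdealRing.of_surjective` (no ring of
integers of a quadratic field in Mathlib: searched `NumberTheory/NumberField`, `NumberTheory/Zsqrtd`).  Tree: `OmegaIntegers.trace_ratCast_add_ratCast_mul`
(generic `d`), `Quadratic.exists_eq_add_mul`, the `EuclideanDomain (ℤ√(-2))` instance of `DiophantineGeometry/MordellEquationMinusTwo`.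
-/

noncomputable section

open Module NumberField

namespace Literature.NumberTheory.QuadraticFields.SqrtNegTwoIntegers

open Literature.NumberTheory.QuadraticFields.Quadratic (exists_eq_add_mul)

variable {K : Type*} [Field K] [NumberField K] {θ : K}

/-! ## §1 The map `ℤ[√−2] → K` -/

omit [NumberField K] in
/-- `θ · θ = −2` in the shape required by `Zsqrtd.lift`. [cite: Marcus2018, Ch. 2 Cor. 2 of Thm. 1] -/
theorem mul_self_eq (hsq : θ ^ 2 = -2) : θ * θ = ((-2 : ℤ) : K) := by
  rw [← sq, hsq]; push_cast; ring

/-- **The ring map `ℤ[√−2] → K`, `a + b√−2 ↦ a + bθ`** (Mathlib's universal property `Zsqrtd.lift`). [cite: Marcus2018, Ch. 2 Cor. 2 of Thm. 1] -/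
def toField (θ : K) (hsq : θ ^ 2 = -2) : ℤ√(-2) →+* K := Zsqrtd.lift ⟨θ, mul_self_eq hsq⟩

omit [NumberField K] in
/-- `toField (a + b√−2) = a + bθ`. [cite: Marcus2018, Ch. 2 Cor. 2 of Thm. 1] -/
theorem toField_apply (hsq : θ ^ 2 = -2) (z : ℤ√(-2)) : toField θ hsq z = (z.re : K) + (z.im : K) * θ := by
  rw [toField, Zsqrtd.lift_apply_apply]

omit [NumberField K] in
/-- `toField √−2 = θ`. [cite: Marcus2018, Ch. 2 Cor. 2 of Thm. 1] -/
theorem toField_sqrtd (hsq : θ ^ 2 = -2) : toField θ hsq Zsqrtd.sqrtd = θ := by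
  rw [toField_apply]; simp [Zsqrtd.sqrtd]

omit [NumberField K] in
/-- `θ² = −2` in the `ℤ`-cast shape of `OmegaIntegers.trace_ratCast_add_ratCast_mul`. [cite: Marcus2018, Ch. 2 Thm. 1] -/
theorem sq_eq_intCast (hsq : θ ^ 2 = -2) : θ ^ 2 = ((-2 : ℤ) : K) := by rw [hsq]; push_cast; ring

/-- `θ ∉ ℚ` (`θ² = −2 < 0`). [cite: Marcus2018, Ch. 2 Thm. 1] -/
theorem not_mem_range (hsq : θ ^ 2 = -2) : θ ∉ Set.range (algebraMap ℚ K) := by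
  rintro ⟨r, hr⟩
  have h : algebraMap ℚ K (r ^ 2) = algebraMap ℚ K (-2) := by rw [map_pow, hr, hsq, map_neg, map_ofNat]
  have h' : r ^ 2 = -2 := (algebraMap ℚ K).injective h
  nlinarith [sq_nonneg r]

/-- **`toField` is injective** (`−2` is not a square in `ℤ`). [cite: Marcus2018, Ch. 2 Cor. 2 of Thm. 1] -/
theorem toField_injective (hsq : θ ^ 2 = -2) : Function.Injective (toField θ hsq) :=
  Zsqrtd.lift_injective _ fun n h ↦ by nlinarith [mul_self_nonneg n]

omit [NumberField K] in
/-- `θ` is an algebraic integer (`θ² = −2`). [cite: Marcus2018, Ch. 2 Thm. 1] -/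
theorem isIntegral_theta (hsq : θ ^ 2 = -2) : IsIntegral ℤ θ := by
  refine IsIntegral.of_pow two_pos ?_
  have h : θ ^ 2 = algebraMap ℤ K (-2) := by rw [hsq, map_neg, map_ofNat]
  rw [h]
  exact isIntegral_algebraMap

omit [NumberField K] in
/-- Every `a + bθ` is an algebraic integer. [cite: Marcus2018, Ch. 2 Cor. 2 of Thm. 1] -/
theorem isIntegral_toField (hsq : θ ^ 2 = -2) (z : ℤ√(-2)) : IsIntegral ℤ (toField θ hsq z) := by
  rw [toField_apply, show (z.re : K) = algebraMap ℤ K z.re from (eq_intCast _ _).symm,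
    show (z.im : K) = algebraMap ℤ K z.im from (eq_intCast _ _).symm]
  exact isIntegral_algebraMap.add (isIntegral_algebraMap.mul (isIntegral_theta hsq))

/-- In a quadratic field there is an automorphism `c ≠ 1`. [cite: Marcus2018, Ch. 2 (the conjugation `√m ↦ −√m`)] -/
theorem exists_algEquiv_ne_one (h2 : finrank ℚ K = 2) : ∃ c : K ≃ₐ[ℚ] K, c ≠ 1 := by
  haveI : Algebra.IsQuadraticExtension ℚ K := { finrank_eq_two' := h2 }
  have hcard : Nat.card (K ≃ₐ[ℚ] K) = 2 := by rw [IsGalois.card_aut_eq_finrank, h2]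
  haveI : Nontrivial (K ≃ₐ[ℚ] K) := by rw [← Finite.one_lt_card_iff_nontrivial, hcard]; exact one_lt_two
  exact exists_ne (1 : K ≃ₐ[ℚ] K)

/-- `N_{K/ℚ}(x) = x · c x` for the non-trivial automorphism `c` of a quadratic field. [cite: Marcus2018, Ch. 2 (norm `N(α) = α·ᾱ`)] -/
theorem algebraMap_norm_eq_mul (h2 : finrank ℚ K = 2) {c : K ≃ₐ[ℚ] K} (hc : c ≠ 1) (x : K) :
    algebraMap ℚ K (Algebra.norm ℚ x) = x * c x := by
  classical
  haveI : Algebra.IsQuadraticExtension ℚ K := { finrank_eq_two' := h2 }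
  have hcard : Fintype.card (K ≃ₐ[ℚ] K) = 2 := by rw [← Nat.card_eq_fintype_card, IsGalois.card_aut_eq_finrank, h2]
  have huniv : ({1, c} : Finset (K ≃ₐ[ℚ] K)) = Finset.univ :=
    Finset.eq_univ_of_card _ (by rw [Finset.card_pair (Ne.symm hc), hcard])
  rw [Algebra.norm_eq_prod_automorphisms, ← huniv, Finset.prod_pair (Ne.symm hc), AlgEquiv.one_apply]

/-- **`c θ = −θ`** for the non-trivial automorphism `c`. [cite: Marcus2018, Ch. 2 (the conjugation `√m ↦ −√m`)] -/
theorem algEquiv_theta (h2 : finrank ℚ K = 2) (hsq : θ ^ 2 = -2) {c : K ≃ₐ[ℚ] K} (hc : c ≠ 1) : c θ = -θ := by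
  have hsq' : (c θ - θ) * (c θ + θ) = 0 := by
    have : c θ ^ 2 = θ ^ 2 := by rw [← map_pow, hsq, map_neg, map_ofNat]
    linear_combination this
  rcases mul_eq_zero.mp hsq' with h | h
  · exfalso
    apply hc
    rw [sub_eq_zero] at h
    apply AlgEquiv.ext
    intro y
    obtain ⟨r, s, rfl⟩ := exists_eq_add_mul h2 (not_mem_range hsq) y
    rw [map_add, map_mul, AlgEquiv.commutes, AlgEquiv.commutes, h, AlgEquiv.one_apply]
  · exact eq_neg_of_add_eq_zero_left h

/-- **`N_{K/ℚ}(r + sθ) = r² + 2s²`.** [cite: Marcus2018, Ch. 2 Thm. 1 (proof)] -/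
theorem norm_ratCast_add_ratCast_mul (h2 : finrank ℚ K = 2) (hsq : θ ^ 2 = -2) (r s : ℚ) :
    Algebra.norm ℚ ((r : K) + (s : K) * θ) = r ^ 2 + 2 * s ^ 2 := by
  obtain ⟨c, hc⟩ := exists_algEquiv_ne_one h2
  apply (algebraMap ℚ K).injective
  have hr : c (r : K) = r := by rw [← eq_ratCast (algebraMap ℚ K), AlgEquiv.commutes]
  have hs : c (s : K) = s := by rw [← eq_ratCast (algebraMap ℚ K), AlgEquiv.commutes]
  rw [algebraMap_norm_eq_mul h2 hc, map_add, map_mul, hr, hs, algEquiv_theta h2 hsq hc, eq_ratCast]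
  push_cast
  linear_combination (-(s : K) ^ 2) * hsq

/-! ## §2 Every algebraic integer of `K` lies in `ℤ[√−2]` -/

/-- **The arithmetic core**: if `2r = m`, `r² + 2s² = n` and `4s = u` are integers, then `r, s ∈ ℤ` (from `16n = 4m² + 2u²`: `u` even,
then `m` even, then `u/2` even). [cite: Marcus2018, Ch. 2 Thm. 1 (proof, case m ≡ 2, 3 mod 4)] -/
theorem exists_coords {r s : ℚ} {m n u : ℤ} (hm : (m : ℚ) = 2 * r) (hn : (n : ℚ) = r ^ 2 + 2 * s ^ 2) (hu : (u : ℚ) = 4 * s) :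
    ∃ a b : ℤ, r = a ∧ s = b := by
  have key : 16 * n = 4 * m ^ 2 + 2 * u ^ 2 := by
    have : (16 * n : ℚ) = 4 * m ^ 2 + 2 * u ^ 2 := by rw [hn, hm, hu]; ring
    exact_mod_cast this
  -- `u` is even
  obtain ⟨t, rfl⟩ : ∃ t, u = 2 * t := by
    rcases Int.even_or_odd u with ⟨t, ht⟩ | ⟨t, ht⟩
    · exact ⟨t, by rw [ht]; ring⟩
    · exfalso
      have e : u ^ 2 = 4 * (t ^ 2 + t) + 1 := by rw [ht]; ring
      rw [e] at key; omega
  -- `m` is even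
  obtain ⟨a, rfl⟩ : ∃ a, m = 2 * a := by
    rcases Int.even_or_odd m with ⟨a, ha⟩ | ⟨a, ha⟩
    · exact ⟨a, by rw [ha]; ring⟩
    · exfalso
      have e : m ^ 2 = 4 * (a ^ 2 + a) + 1 := by rw [ha]; ring
      have e2 : (2 * t) ^ 2 = 4 * t ^ 2 := by ring
      rw [e, e2] at key; omega
  -- `t` is even
  obtain ⟨b, rfl⟩ : ∃ b, t = 2 * b := by
    rcases Int.even_or_odd t with ⟨b, hb⟩ | ⟨b, hb⟩
    · exact ⟨b, by rw [hb]; ring⟩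
    · exfalso
      have e : (2 * t) ^ 2 = 16 * (b ^ 2 + b) + 4 := by rw [hb]; ring
      have e2 : (2 * a) ^ 2 = 4 * a ^ 2 := by ring
      rw [e, e2] at key; omega
  refine ⟨a, b, ?_, ?_⟩
  · have : (2 * a : ℤ) = (2 : ℚ) * r := by exact_mod_cast hm
    push_cast at this; linarith
  · have : (2 * (2 * b) : ℤ) = (4 : ℚ) * s := by exact_mod_cast hu
    push_cast at this; linarith

/-- ★ **Every algebraic integer of `K = ℚ(√−2)` is `a + bθ` with `a, b ∈ ℤ`** (Marcus's Cor. 2 for `m = −2`): `𝓞 K ⊆ ℤ[θ]`, by the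
trace `2r`, the norm `r² + 2s²`, and `(4s)² = 2(4N − Tr²) ∈ ℤ ⇒ 4s ∈ ℤ` (`ℤ` integrally closed). [cite: Marcus2018, Ch. 2 Thm. 1 and Cor. 2] -/
theorem exists_toField_eq_of_isIntegral (h2 : finrank ℚ K = 2) (hsq : θ ^ 2 = -2) {z : K} (hz : IsIntegral ℤ z) :
    ∃ w : ℤ√(-2), toField θ hsq w = z := by
  have hθ := not_mem_range hsq
  obtain ⟨r, s, hz'⟩ := exists_eq_add_mul h2 hθ z
  rw [eq_ratCast, eq_ratCast] at hz'
  have exists_intCast_eq : ∀ {w : ℚ}, IsIntegral ℤ w → ∃ m : ℤ, (m : ℚ) = w :=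
    fun hw ↦ IsIntegrallyClosed.isIntegral_iff.mp hw
  -- trace and norm are rational integers
  obtain ⟨m, hm⟩ : ∃ m : ℤ, (m : ℚ) = 2 * r := by
    obtain ⟨m, hm⟩ := exists_intCast_eq (Algebra.isIntegral_trace hz)
    exact ⟨m, by rw [hm, hz', OmegaIntegers.trace_ratCast_add_ratCast_mul h2 hθ (sq_eq_intCast hsq)]⟩
  obtain ⟨n, hn⟩ : ∃ n : ℤ, (n : ℚ) = r ^ 2 + 2 * s ^ 2 := by
    obtain ⟨n, hn⟩ := exists_intCast_eq (Algebra.isIntegral_norm ℚ hz)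
    exact ⟨n, by rw [hn, hz', norm_ratCast_add_ratCast_mul h2 hsq]⟩
  -- `4s` is a rational integer: `(4s)² = 2(4n − m²)`
  obtain ⟨u, hu⟩ : ∃ u : ℤ, (u : ℚ) = 4 * s := by
    refine exists_intCast_eq (IsIntegral.of_pow two_pos ?_)
    have h : (4 * s : ℚ) ^ 2 = algebraMap ℤ ℚ (2 * (4 * n - m ^ 2)) := by
      rw [eq_intCast]; push_cast; rw [hn, hm]; ring
    rw [h]
    exact isIntegral_algebraMap
  obtain ⟨a, b, hr, hs⟩ := exists_coords hm hn hu
  refine ⟨⟨a, b⟩, ?_⟩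
  rw [toField_apply, hz', hr, hs]
  push_cast
  ring

/-! ## §3 The isomorphism `ℤ[√−2] ≅ 𝓞 K` -/

/-- The ring map `ℤ[√−2] → 𝓞 K` (`toField` with its integrality certificate). [cite: Marcus2018, Ch. 2 Cor. 2 of Thm. 1] -/
def toIntegers (θ : K) (hsq : θ ^ 2 = -2) : ℤ√(-2) →+* 𝓞 K where
  toFun := RingOfIntegers.restrict (toField θ hsq) (isIntegral_toField hsq)
  map_one' := by simp only [RingOfIntegers.restrict, map_one]; rfl
  map_mul' z w := by simp only [RingOfIntegers.restrict, map_mul]; rfl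
  map_zero' := by simp only [RingOfIntegers.restrict, map_zero]; rfl
  map_add' z w := by simp only [RingOfIntegers.restrict, map_add]; rfl

omit [NumberField K] in
/-- `toIntegers z`, as an element of `K`, is `toField z`. [cite: Marcus2018, Ch. 2 Cor. 2 of Thm. 1] -/
theorem coe_toIntegers (hsq : θ ^ 2 = -2) (z : ℤ√(-2)) : ((toIntegers θ hsq z : 𝓞 K) : K) = toField θ hsq z := rfl

/-- `toIntegers` is a bijection `ℤ[√−2] → 𝓞 K`. [cite: Marcus2018, Ch. 2 Thm. 1 and Cor. 2] -/
theorem toIntegers_bijective (h2 : finrank ℚ K = 2) (hsq : θ ^ 2 = -2) : Function.Bijective (toIntegers θ hsq) := by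
  refine ⟨fun z w h ↦ toField_injective hsq ?_, fun t ↦ ?_⟩
  · have := congrArg (fun u : 𝓞 K ↦ (u : K)) h
    simpa only [coe_toIntegers] using this
  · obtain ⟨w, hw⟩ := exists_toField_eq_of_isIntegral h2 hsq (RingOfIntegers.isIntegral_coe t)
    exact ⟨w, RingOfIntegers.ext (by rw [coe_toIntegers, hw])⟩

/-- ★★ **`ℤ[√−2] ≅ 𝓞 ℚ(√−2)`**: the ring isomorphism `ℤ√(-2) ≃+* 𝓞 K` for any quadratic number field `K ∋ θ`, `θ² = −2`.
[cite: Marcus2018, Ch. 2 Thm. 1 and Cor. 2] -/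
def equivIntegers (h2 : finrank ℚ K = 2) (hsq : θ ^ 2 = -2) : ℤ√(-2) ≃+* 𝓞 K :=
  RingEquiv.ofBijective (toIntegers θ hsq) (toIntegers_bijective h2 hsq)

/-- `equivIntegers z`, as an element of `K`, is `a + bθ`. [cite: Marcus2018, Ch. 2 Cor. 2 of Thm. 1] -/
theorem coe_equivIntegers (h2 : finrank ℚ K = 2) (hsq : θ ^ 2 = -2) (z : ℤ√(-2)) :
    ((equivIntegers h2 hsq z : 𝓞 K) : K) = (z.re : K) + (z.im : K) * θ := by
  rw [← toField_apply hsq]; rfl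

/-- `equivIntegers √−2 = θ`. [cite: Marcus2018, Ch. 2 Cor. 2 of Thm. 1] -/
theorem coe_equivIntegers_sqrtd (h2 : finrank ℚ K = 2) (hsq : θ ^ 2 = -2) :
    ((equivIntegers h2 hsq Zsqrtd.sqrtd : 𝓞 K) : K) = θ := by
  rw [coe_equivIntegers]; simp [Zsqrtd.sqrtd]

/-- **`𝓞 ℚ(√−2)` is a principal ideal ring** (transported from the Euclidean domain `ℤ[√−2]`). [cite: Marcus2018, Ch. 5 Exercise 9 (m = −2)] -/
theorem isPrincipalIdealRing_ringOfIntegers (h2 : finrank ℚ K = 2) (hsq : θ ^ 2 = -2) : IsPrincipalIdealRing (𝓞 K) :=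
  IsPrincipalIdealRing.of_surjective (equivIntegers h2 hsq).toRingHom (equivIntegers h2 hsq).surjective

end Literature.NumberTheory.QuadraticFields.SqrtNegTwoIntegers

end
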